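import Summits.QuantumFields.BalabanUV.T4Continuum.Support.NE4ReadOutSocketMarginal

/-!
# NE4ReadOutSocketMarginalRecipe — node U2's read-out feeds row NE9's marginal projection: EXACTNESS of the dictionary and
# the PROBE-RECIPE discharge of the projection's read-out binders; §1's triple of the sibling with NO read-out binder left
# (cell `pub-balaban`, T⁴-continuum fan-out, `HOME/BINDER-OWNERS.md` row NE4, owner lineage t4-ne4-p1, generation 35;
# technique lane P1 = discrete Grönwall / fading memory; row NE9 claim table (w8) «RO-junction», node-U2 half)

HONEST FRAMING (T4-DAG PAGE 1).  Rung (B)+1 on a FIXED finite torus T⁴ — NOT infinite volume, NOT a mass gap, NOT the Clay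
problem.  NE4 (node U2) is DEPENDENT = (R)∘{NE5, NE9}; NE5, NE9 are the cell's own estimates, NOT PRINTED, NOT PROVED; spine
estimates proved 0/9, unchanged by this module.  [I] = [Balaban1987RG1] is quoted for TYPES/STRUCTURE only (ABSOLUTE RULE).
`FlowStep.BetaPertH`, (B), (B^μ) do not occur.  HONEST DEPENDENCY (cell, verbatim): continuum YM on T⁴ ⇐ BetaPertH ∧ nine
spine estimates (0/9 proved); BetaPertH ⇐ (D1) ∧ (D4) ∧ CAP+tail; G-an2-4 gates asym, D1 and NE2/3/4.

WHAT THIS MODULE IS.  The sibling `NE4ReadOutSocketMarginal` (§1 `ne4_of_margNE9_NE5`) consumes row NE9's marginal-projection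
END with the projection read by node U2's OWN read-out `rA` (`r := NE9MarginalProjection.shiftRead rA`), displaying the
linearity binders `hrA0` / `hrAadd`, the class binders `hAdmA : Adm ⊆ 𝒜A` / `h0A : 0 ∈ 𝒜A` and (R) `hr` / `hcov`.  Here:

* §1 EXACTNESS (kernel, not dictionary).  `readOut_restrictScale_eq`: a read-out `ReadBoundedOn` a class reads a family and
  its scale-(k+1) restriction alike (closeness 0).  `margProj_shiftRead_eq_package`: if moreover `rA` REPRESENTS the cell's β
  (`T4BetaReadOut.RepresentsA`, the structure of (1.20)–(1.22) p. 264 of [I]), then on every domain of the creation step k + 1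
  `margProj (shiftRead rA) A (EA (extd v)) U X = EA (extd v) U X − β k v · A U X` — the summand `{−β_{k+1}(g_k)A + 𝐄^{(k+1)}}`
  of (1.3) p. 260 with the cell's OWN β-function: the counterterm the projection re-attaches IS the one node U2 reads.
* §2 PROBE RECIPES (`T4BetaReadOutLipschitz.Probes`, node U2's kernel (R), cr = 8K/α²): the three read-out binders of row NE9's
  projection are THEOREMS for `r := shiftRead P.recipe` on any admissible class of slices with analytic charts of radius α —
  `recipe_zero`, `recipe_restrictScale` (reading the restriction = reading the family), `recipe_sub` (linearity,
  `T4BetaReadOutLipschitz.mixedDeriv_sub`), `zero_mem_analytic`, `restrictScale_mem_analytic`, whence `readZero_recipe`,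
  `readAdditive_recipe`, `readSize_recipe` (`readBoundedOn_recipe` through row NE9's junction `readSize_of_readBoundedOn`) and
  the projection binders `projBinders_recipe` (`ProjAdditive ∧ ProjScaleComm ∧ ProjSize`, cost factor `1 + (8K/α²)·aA`).
* §3 `ne4_of_margNE9_NE5_recipe` — the sibling's §1 for a probe recipe `PB` (run B) and its transport (run A): node U2's
  TRIPLE on row NE9's marginal-projection END with NO read-out binder left — (R) `hr`/`hcov`, `h0A`, `hrA0`, `hrAadd` ALL
  kernel; displayed instead: the chart radius `α > 0`, the locality sum `K` (`Probes.LocalitySum`, printed TYPE, unprinted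
  number), non-empty probe sets, and the printed-type analyticity of the admissible slices `Adm ⊆ PB.transportTo.Analytic α`
  ((1.17) p. 263 / (4.4) p. 281).  Constants `cr = 8K/α²` throughout, memory rate `ω + 8·lipbar·B·((1 + (8K/α²)·aA)·τ̄)`.

WHAT STAYS OPEN after this (no row owns it): the identification of the (1.20) probe configurations of [I] — domains, the
responses `h_X(x)` as directions, the (1.21)–(1.22) weights, the complex chart backgrounds with Re/Im tags — as a `Probes`
DATUM, and of Bałaban's 𝐄^{(j)} as the `Functional` it reads (the instantiation layer O1); row NE9's `ProjInto` (normalisation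
of the recipe against the marginal direction `A`); rows NE5/NE9 themselves.

WHAT IS PROVED: elementary kernel facts (a read-out bound at closeness 0 forces equality; linearity of a finite sum of (4.3)
mixed derivatives of analytic chart functions; constants are analytic) and one composition BY NAME.  0 sorry; axioms ⊆
{propext, Classical.choice, Quot.sound}.  Nothing of [I] is asserted.  Rung (B)+1 finite T⁴; NOT summit progress.

References (TYPES/STRUCTURE only): [Balaban1987RG1] CMP 109 (1987) (1.3) p. 260, (1.17)–(1.18) p. 263, (1.20)–(1.22) p. 264,
(4.3)–(4.5) pp. 281–282.
-/

noncomputable section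

namespace Summit.QuantumFields.BalabanUV.T4Continuum.NE4ReadOutSocketMarginalRecipe

open scoped BigOperators
open Metric
open Literature.MathematicalPhysics.QuantumFieldTheory.Balaban1983to89
open FlowStep (HBeta Box)
open T4OutputRate (Carriers Functional NE5)
open T4CouplingMatching (ScaleShiftRate HistLipschitz)
open T4BetaReadOut (Slice ReadOut SliceClose RepresentsA RepresentsB)
open T4BetaReadOutLipschitz (ReadBoundedOn Probes)
open T4FlagMemory (extd)
open B12Decay510 (mixedDeriv)
open T4HistoryLipschitzRecursion (prodModuli restrictScale restrictScale_of_eq restrictScale_of_ne ScaleZeroFree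
  AdmissibleTerms AdmRestrict ChannelAdditive ChannelStepSum ChannelSizeAtStepNN)
open T4HistoryLipschitzOuter (Factorises)
open T4HistoryLipschitzActivity (ClusterGeom)
open T4HistoryLipschitzSegment (TwoPointKP sizeRadius)
open NE9MarginalProjection (compProj margProj shiftRead ReadAdditive ReadZero ReadSize DirSize ProjAdditive ProjScaleComm
  ProjInto ProjSize projAdditive_margProj projScaleComm_margProj projSize_margProj readZero_shiftRead readAdditive_shiftRead
  readSize_of_readBoundedOn)
open NE4ReadOutSocketMarginal (ne4_of_margNE9_NE5)

variable {C : Carriers}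

/-! ## §1 Exactness: the projected family is the (1.3) package with the cell's β -/

/-- A read-out bound on a class forces the recipe to read a family and its scale-(k+1) restriction alike (closeness 0 on
the slice). [folklore] -/
theorem readOut_restrictScale_eq {Bg : Type} {𝒜A : Set (Slice C Bg)} {rA : ReadOut C Bg} {κ cr : ℝ}
    (hr : ReadBoundedOn 𝒜A rA κ cr) {F : Slice C Bg} {k : ℕ} (hF : F ∈ 𝒜A) (hFr : restrictScale (k + 1) F ∈ 𝒜A) :
    rA k (restrictScale (k + 1) F) = rA k F := by
  have hclose : SliceClose κ k (restrictScale (k + 1) F) F 0 := by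
    intro U Y hY
    rw [restrictScale_of_eq F hY, sub_self, abs_zero, zero_mul]
  have h := hr k _ _ 0 hFr hF hclose
  rw [mul_zero, abs_nonpos_iff, sub_eq_zero] at h
  exact h

/-- **EXACTNESS OF THE DICTIONARY `T := 𝒯 ∘ margProj r A` AT NODE U2's READ-OUT.**  If `rA` REPRESENTS the cell's β
((1.20)–(1.22) p. 264 of [I]: `β k v = rA k (EA (extd v))` on the box) and is `ReadBoundedOn` a class containing the
admissible families and their scale restrictions, then on every domain of the creation step k + 1 the projected family
`margProj (shiftRead rA) A (EA (extd v))` EQUALS `EA (extd v) U X − β k v · A U X` — the summand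
`{−β_{k+1}(g_k)A(U) + 𝐄^{(k+1)}(g_k, U)}` of (1.3) p. 260 with the cell's own β-function: the counterterm the projection
re-attaches IS the one node U2 reads. [cite: Balaban1987RG1, (1.3) p.260 and (1.20)-(1.22) p.264] -/
theorem margProj_shiftRead_eq_package {EA : Functional C C.BgA} {W : Set (ℕ → ℝ)} {Adm : Set (C.BgA → C.Dom → ℝ)}
    {𝒜A : Set (Slice C C.BgA)} {rA : ReadOut C C.BgA} {β : HBeta} {γ κ cr : ℝ} (A : Slice C C.BgA)
    (hW : ∀ k (v : Fin (k + 1) → ℝ), v ∈ Box γ k → extd v ∈ W) (hAdm : AdmissibleTerms EA W Adm) (hres : AdmRestrict Adm)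
    (hAdmA : Adm ⊆ 𝒜A) (hA : RepresentsA EA rA γ β) (hr : ReadBoundedOn 𝒜A rA κ cr)
    {k : ℕ} {v : Fin (k + 1) → ℝ} (hv : v ∈ Box γ k) {U : C.BgA} {Y : C.Dom} (hY : C.scale Y = k + 1) :
    margProj (shiftRead rA) A (EA (extd v)) U Y = EA (extd v) U Y - β k v * A U Y := by
  have hmem : EA (extd v) ∈ Adm := hAdm.1 _ (hW k v hv)
  have hread : shiftRead rA (k + 1) (restrictScale (k + 1) (EA (extd v))) = β k v := by
    simp only [shiftRead, Nat.succ_ne_zero, if_false, Nat.succ_sub_one]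
    rw [readOut_restrictScale_eq hr (hAdmA hmem) (hAdmA (hres.1 _ hmem (k + 1))), hA k v hv]
  simp only [margProj]
  rw [hY, hread]

/-! ## §2 Probe recipes: the three read-out binders of the projection are theorems -/

section ProbeRecipes

variable {Bg : Type} {V : Type*} [NormedAddCommGroup V] [NormedSpace ℂ V] {ιp : Type*}

/-- The rebuilt chart function of the ZERO slice is the zero function. [folklore] -/
theorem cplx_zero (Pr : Probes C Bg V ιp) (k : ℕ) (p : ιp) : Pr.cplx (0 : Slice C Bg) k p = 0 := by
  funext A'
  simp [Probes.cplx]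

/-- The (4.3) mixed derivative of the zero function vanishes. [cite: Balaban1987RG1, (4.3) p.281] -/
theorem mixedDeriv_zero (a b : V) : mixedDeriv (0 : V → ℂ) a b = 0 := by
  simp [mixedDeriv, fderiv_zero]

/-- **A probe recipe reads 0 from the zero family** ((1.20)–(1.22) is linear). [cite: Balaban1987RG1, (1.20)-(1.22) p.264] -/
theorem recipe_zero (Pr : Probes C Bg V ιp) (k : ℕ) : Pr.recipe k (0 : Slice C Bg) = 0 := by
  simp only [Probes.recipe, cplx_zero, mixedDeriv_zero, Complex.zero_re, mul_zero, Finset.sum_const_zero]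

/-- Reading the scale-(k+1) restriction of a family = reading the family (the probes' domains lie on that slice).
[cite: Balaban1987RG1, (1.20)-(1.22) p.264] -/
theorem cplx_restrictScale (Pr : Probes C Bg V ιp) (F : Slice C Bg) {k : ℕ} {p : ιp} (hp : p ∈ Pr.idx k) :
    Pr.cplx (restrictScale (k + 1) F) k p = Pr.cplx F k p := by
  funext A'
  simp only [Probes.cplx, restrictScale_of_eq F (Pr.scale_dom k p hp)]

/-- The recipe of the scale-(k+1) restriction is the recipe of the family. [cite: Balaban1987RG1, (1.20)-(1.22) p.264] -/
theorem recipe_restrictScale (Pr : Probes C Bg V ιp) (F : Slice C Bg) (k : ℕ) :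
    Pr.recipe k (restrictScale (k + 1) F) = Pr.recipe k F := by
  simp only [Probes.recipe]
  exact Finset.sum_congr rfl fun p hp => by rw [cplx_restrictScale Pr F hp]

/-- The rebuilt chart function of a difference is the difference. [folklore] -/
theorem cplx_sub (Pr : Probes C Bg V ιp) (F G' : Slice C Bg) (k : ℕ) (p : ιp) :
    Pr.cplx (F - G') k p = Pr.cplx F k p - Pr.cplx G' k p := by
  funext A'
  simp only [Probes.cplx, Pi.sub_apply]
  push_cast
  ring

/-- **A probe recipe is additive on slices with analytic charts** (`T4BetaReadOutLipschitz.mixedDeriv_sub`: linearity of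
the (4.3) mixed derivative for analytic chart functions). [cite: Balaban1987RG1, (1.20) p.264 and (4.3)-(4.4) p.281] -/
theorem recipe_sub (Pr : Probes C Bg V ιp) {α : ℝ} (hα : 0 < α) {F G' : Slice C Bg} (hF : F ∈ Pr.Analytic α)
    (hG : G' ∈ Pr.Analytic α) (k : ℕ) : Pr.recipe k (F - G') = Pr.recipe k F - Pr.recipe k G' := by
  simp only [Probes.recipe]
  rw [← Finset.sum_sub_distrib]
  refine Finset.sum_congr rfl fun p hp => ?_
  rw [cplx_sub, T4BetaReadOutLipschitz.mixedDeriv_sub hα (hF k p hp) (hG k p hp), Complex.sub_re, mul_sub]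

/-- The zero slice has analytic (identically zero) charts. [folklore] -/
theorem zero_mem_analytic (Pr : Probes C Bg V ιp) (α : ℝ) : (0 : Slice C Bg) ∈ Pr.Analytic α := by
  intro k p _
  rw [cplx_zero]
  exact analyticOnNhd_const

/-- Scale restriction preserves the analytic class: at the read step the charts are unchanged, at every other step they
vanish. [folklore] -/
theorem restrictScale_mem_analytic (Pr : Probes C Bg V ιp) {α : ℝ} {F : Slice C Bg} (hF : F ∈ Pr.Analytic α) (j : ℕ) :
    restrictScale j F ∈ Pr.Analytic α := by
  intro k p hp
  by_cases hj : j = k + 1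
  · subst hj
    rw [cplx_restrictScale Pr F hp]
    exact hF k p hp
  · have h0 : Pr.cplx (restrictScale j F) k p = 0 := by
      funext A'
      have hne : C.scale (Pr.dom k p) ≠ j := by rw [Pr.scale_dom k p hp]; exact Ne.symm hj
      simp only [Probes.cplx, restrictScale_of_ne F hne]
      simp
    rw [h0]
    exact analyticOnNhd_const

/-- **`ReadZero` FOR PROBE RECIPES (kernel).** [cite: Balaban1987RG1, (1.20)-(1.22) p.264] -/
theorem readZero_recipe (Pr : Probes C Bg V ιp) : ReadZero (shiftRead Pr.recipe) :=
  readZero_shiftRead (recipe_zero Pr)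

/-- **`ReadAdditive` FOR PROBE RECIPES (kernel)** on any admissible class of slices with analytic charts of radius α.
[cite: Balaban1987RG1, (1.20)-(1.22) p.264 and (4.4) p.281] -/
theorem readAdditive_recipe (Pr : Probes C Bg V ιp) {α : ℝ} (hα : 0 < α) {Adm : Set (Slice C Bg)}
    (hAn : Adm ⊆ Pr.Analytic α) : ReadAdditive Adm (shiftRead Pr.recipe) := by
  refine readAdditive_shiftRead fun k H₁ h₁ H₂ h₂ => ?_
  rw [recipe_restrictScale, recipe_restrictScale, recipe_restrictScale]
  exact recipe_sub Pr hα (hAn h₁) (hAn h₂) k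

/-- **`ReadSize` FOR PROBE RECIPES (kernel)**, constant `cr = 8K/α²`: node U2's `readBoundedOn_recipe` through row NE9's
junction `readSize_of_readBoundedOn`. [cite: Balaban1987RG1, (1.18) p.263, (1.20)-(1.22) p.264 and (4.3)-(4.5) pp.281-282] -/
theorem readSize_recipe (Pr : Probes C Bg V ιp) {α κ K : ℝ} (hα : 0 < α) (hK : Pr.LocalitySum κ K)
    (hne : ∀ k, (Pr.idx k).Nonempty) {Adm : Set (Slice C Bg)} (hAn : Adm ⊆ Pr.Analytic α) :
    ReadSize Adm (shiftRead Pr.recipe) κ (8 * K / α ^ 2) :=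
  readSize_of_readBoundedOn (Pr.readBoundedOn_recipe hα hK hne) (zero_mem_analytic Pr α)
    (fun _ hH j => restrictScale_mem_analytic Pr (hAn hH) j) (recipe_zero Pr)
    (div_nonneg (mul_nonneg (by norm_num) (Pr.localitySum_nonneg hK)) (sq_nonneg α))

/-- **THE PROJECTION BINDERS OF ROW NE9's END FOR PROBE RECIPES (kernel).**  For `P := margProj (shiftRead P.recipe) A` on
an admissible class of analytic slices and a marginal direction of size `aA`: `ProjAdditive`, `ProjScaleComm`, `ProjSize`
with the cost factor `1 + (8K/α²)·aA` — three of the four projection binders of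
`NE9MarginalProjectionEnd.ne9_and_fadingMemory_of_couplingTwoPoint_vacSub_sizeInduction_compProj` are THEOREMS; `ProjInto`
(normalisation of the recipe against `A`) and the datum itself stay with the instantiation layer.
[cite: Balaban1987RG1, (1.3) p.260, (1.18) p.263 and (1.20)-(1.22) p.264] -/
theorem projBinders_recipe (Pr : Probes C Bg V ιp) {α κ K aA : ℝ} (hα : 0 < α) (hK : Pr.LocalitySum κ K)
    (hne : ∀ k, (Pr.idx k).Nonempty) {Adm : Set (Slice C Bg)} (hAn : Adm ⊆ Pr.Analytic α) {A : Slice C Bg}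
    (hDir : DirSize A κ aA) :
    ProjAdditive Adm (margProj (shiftRead Pr.recipe) A) ∧ ProjScaleComm Adm (margProj (shiftRead Pr.recipe) A) ∧
      ProjSize Adm (margProj (shiftRead Pr.recipe) A) κ (8 * K / α ^ 2 * aA) :=
  ⟨projAdditive_margProj A (readAdditive_recipe Pr hα hAn), projScaleComm_margProj Adm A (readZero_recipe Pr),
    projSize_margProj (readSize_recipe Pr hα hK hne hAn) hDir
      (div_nonneg (mul_nonneg (by norm_num) (Pr.localitySum_nonneg hK)) (sq_nonneg α))⟩

end ProbeRecipes

/-! ## §3 Node U2's triple on the marginal-projection END with no read-out binder left -/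

section RecipeFace

variable {V : Type*} [NormedAddCommGroup V] [NormedSpace ℂ V] {ιp : Type*}

/-- **ROW NE4 — NODE U2's TRIPLE ON ROW NE9's MARGINAL-PROJECTION END, READ BY A PROBE RECIPE: NO READ-OUT BINDER LEFT.**
The sibling's `NE4ReadOutSocketMarginal.ne4_of_margNE9_NE5` with `rA := PB.transportTo.recipe`, `rB := PB.recipe`,
`𝒜A := PB.transportTo.Analytic α`, `𝒜B := PB.Analytic α`, `cr := 8K/α²`: (R) `hr` / `hcov` := `readBoundedOn_recipe` /
`readCovariantOn_recipe` (node U2, kernel), `h0A` := `zero_mem_analytic`, `hrA0` := `recipe_zero`, `hrAadd` := `recipe_sub` ∘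
`recipe_restrictScale` (§2).  Displayed instead: `hα`, `hK : PB.LocalitySum κ K`, `hne`, and `hAdmA : Adm ⊆
PB.transportTo.Analytic α` (the admissible run-A families have analytic charts of radius α at every probe — printed TYPE
(1.17)/(4.4), a HYPOTHESIS on the instancer's slices).  Row NE9's END binders and `ProjInto`, row NE5 by shape, `hW`/`hA`/`hB`
as in the sibling.  Nothing of [I] is asserted. [cite: Balaban1987RG1, (1.17)-(1.18) p.263, (1.20)-(1.22) p.264 and (4.3)-(4.5) pp.281-282] -/
theorem ne4_of_margNE9_NE5_recipe (G : ClusterGeom C) {Pot : Type*} [NormedAddCommGroup Pot] [NormedSpace ℂ Pot]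
    (PB : Probes C C.BgB V ιp) {ιc : Type} {EA : Functional C C.BgA} {W : Set (ℕ → ℝ)} {Adm MF : Set (C.BgA → C.Dom → ℝ)}
    {A : C.BgA → C.Dom → ℝ} {𝒯 : ℕ → (ℕ → ℝ) → (C.BgA → C.Dom → ℝ) → ιc → ℝ}
    {Ψ : ℕ → ℝ → (ιc → ℝ) → C.BgA → C.Dom → ℝ} {act : ℕ → ℝ → C.BgA → Pot → G.P → ℂ} {𝒜 : ℕ → Set Pot}
    {n : ℕ → ℝ → C.BgA → G.P → ℝ} {lip clip : ℕ → ℝ} {aP dP : G.P → ℝ} {δ : C.Dom → ℝ}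
    {κ B lipbar clipbar qTbar τbar ω aA ℓ ν α K : ℝ} {wt : ℕ → ιc → ℝ} {τ : ℕ → ℕ → ℝ} {qT p₀ N : ℕ → ℝ}
    (ρT : ℕ → (ιc → ℝ) → Pot) (U₀ : C.BgA) (explZ : ℕ → C.BgA → C.Dom → ℝ) {β : HBeta} {γ : ℝ}
    -- ===== row NE9's marginal-projection END at `P := margProj (shiftRead PB.transportTo.recipe) A`, cr = 8K/α² =====
    (h0 : ScaleZeroFree EA W) (hAdm : AdmissibleTerms EA W Adm) (hres : AdmRestrict Adm)
    (hDir : DirSize A κ aA) (haA : 0 ≤ aA) (hPinto : ProjInto Adm MF (margProj (shiftRead PB.transportTo.recipe) A))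
    (hadd : ChannelAdditive MF 𝒯) (hsum : ChannelStepSum MF 𝒯) (hstep : ChannelSizeAtStepNN MF 𝒯 κ wt τ)
    (hfac : Factorises EA W (compProj 𝒯 (margProj (shiftRead PB.transportTo.recipe) A)) Ψ) (hclip0 : ∀ k, 0 ≤ clip k)
    (hCup : ∀ g ∈ W, ∀ g' ∈ W, ∀ (k : ℕ) (U : C.BgA) (X : C.Dom), C.scale X = k + 1 → ∀ Q ∈ 𝒜 k, ∀ γ' ∈ G.vol X,
      ‖act k (g k) U Q γ'‖ ≤ n k (g' k) U γ' ∧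
        ‖act k (g k) U Q γ' - act k (g' k) U Q γ'‖ ≤ clip k * |g k - g' k| * n k (g' k) U γ')
    (hqT0 : ∀ k, 0 ≤ qT k)
    (hTcup : ∀ g ∈ W, ∀ g' ∈ W, ∀ (k : ℕ) (y : ιc),
      |compProj 𝒯 (margProj (shiftRead PB.transportTo.recipe) A) k g (EA g) y -
          compProj 𝒯 (margProj (shiftRead PB.transportTo.recipe) A) k g' (EA g) y| ≤ wt k y * (qT k * |g k - g' k|))
    (hreprV : ∀ (k : ℕ) (s : ℝ) (Q : ιc → ℝ) (U : C.BgA) (X : C.Dom),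
      Ψ k s Q U X = (G.newTerm act k s U X (ρT k Q)).re - (G.newTerm act k s U₀ X (ρT k Q)).re + explZ k U X)
    (hclipb : ∀ k, clip k ≤ clipbar) (hqTb : ∀ k, qT k ≤ qTbar)
    (hKP : TwoPointKP G W act 𝒜 n lip aP dP) (hdec : G.DecayExtract δ dP) (hpinB : G.PinBudget aP δ (fun _ => B) κ)
    (hρT : ∀ (k : ℕ) (Q Q' : ιc → ℝ) (M : ℝ), (∀ y, |Q y - Q' y| ≤ wt k y * M) → ‖ρT k Q - ρT k Q'‖ ≤ M)
    (hexplZ : ∀ (k : ℕ) (U : C.BgA) (X : C.Dom), C.scale X = k + 1 → |explZ k U X| ≤ Real.exp (-(κ * C.d X)) * p₀ k)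
    (hbase : ∀ g ∈ W, ∀ (U : C.BgA) (X : C.Dom), C.scale X = 0 → |EA g U X| ≤ Real.exp (-(κ * C.d X)) * N 0)
    (hNsucc : ∀ j, p₀ j + 2 * B ≤ N (j + 1)) (hNnn : ∀ j, 0 ≤ N j)
    (hbox : ∀ (k : ℕ) (Q : ιc → ℝ),
      (∀ y, |Q y| ≤ wt k y * sizeRadius (fun k j => (1 + 8 * K / α ^ 2 * aA) * τ k j) N k) → ρT k Q ∈ 𝒜 k)
    (hB0 : 0 ≤ B) (hlipb : ∀ k, lip k ≤ lipbar) (hτbar : 0 ≤ τbar) (hω : 0 ≤ ω)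
    (hpos : 0 < ω + 8 * lipbar * B * ((1 + 8 * K / α ^ 2 * aA) * τbar))
    (hτ : ∀ k j, j ≤ k → 0 ≤ τ k j ∧ τ k j ≤ τbar * ω ^ (k - j))
    (hℓ : 8 * clipbar * B + 8 * lipbar * B * qTbar = ℓ) (hν : ω + 8 * lipbar * B * ((1 + 8 * K / α ^ 2 * aA) * τbar) = ν)
    -- ===== row NE5 BY SHAPE =====
    {EBfam : ℝ → Functional C C.BgB} {θ₅ C₅ : ℝ} (hNE5f : ∀ b', 0 < b' → b' ≤ γ → NE5 EA (EBfam b') W κ θ₅ C₅)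
    -- ===== node U2: the probe recipe's data in place of (R) =====
    (hW : ∀ k (v : Fin (k + 1) → ℝ), v ∈ Box γ k → extd v ∈ W)
    (hA : RepresentsA EA PB.transportTo.recipe γ β) (hB : RepresentsB EBfam PB.recipe γ β)
    (hAdmA : Adm ⊆ PB.transportTo.Analytic α) (h𝒜B : ∀ b', 0 < b' → b' ≤ γ → ∀ g' ∈ W, EBfam b' g' ∈ PB.Analytic α)
    (hα : 0 < α) (hK : PB.LocalitySum κ K) (hne : ∀ k, (PB.idx k).Nonempty) :
    ScaleShiftRate (8 * K / α ^ 2 * C₅ * θ₅) θ₅ γ β ∧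
      HistLipschitz (fun k i => 8 * K / α ^ 2 * prodModuli ℓ (fun _ => ν) (k + 1) i) γ β ∧
        T4CouplingMatching.FadingMemory (8 * K / α ^ 2 * (ℓ / ν) * ν) ν
          (fun k i => 8 * K / α ^ 2 * prodModuli ℓ (fun _ => ν) (k + 1) i) :=
  ne4_of_margNE9_NE5 G ρT U₀ explZ h0 hAdm hres hDir haA hPinto hadd hsum hstep hfac hclip0 hCup hqT0 hTcup hreprV hclipb
    hqTb hKP hdec hpinB hρT hexplZ hbase hNsucc hNnn hbox hB0 hlipb hτbar hω hpos hτ hℓ hν hNE5f hW hA hB hAdmA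
    (zero_mem_analytic PB.transportTo α) h𝒜B (PB.transportTo.readBoundedOn_recipe hα hK hne)
    (PB.readCovariantOn_recipe hα hK hne) (div_nonneg (mul_nonneg (by norm_num) (PB.localitySum_nonneg hK)) (sq_nonneg α))
    (recipe_zero PB.transportTo)
    (fun k H₁ h₁ H₂ h₂ => by
      rw [recipe_restrictScale, recipe_restrictScale, recipe_restrictScale]
      exact recipe_sub PB.transportTo hα (hAdmA h₁) (hAdmA h₂) k)

end RecipeFace

end Summit.QuantumFields.BalabanUV.T4Continuum.NE4ReadOutSocketMarginalRecipe

end
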